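import Summits.CriticalPhenomena.Ising3DConformalLimit.Theses.EnergyNotSigmaSquared
import Literature.Probability.LatticeModels.CriticalScalingDimension

/-!
# `MoebiusLimit` (item stmt-CriticalPhenomena-1344): inversion covariance alone makes the two-point function radial

Structural knowledge about the crux `…Theses.EnergyNotSigmaSquared.MoebiusLimit`
(= `PerfectScreening.MoebiusLimitExists`), standing crux disprover (D-0016); THEOREM-ONLY, no
Ising input (pure consequences of the covariance predicates of `ConformalCovariance.lean`).

For a family `S` on `ℝ³` which is translation invariant, scale covariant with dimension `Δ'`,
inversion covariant with dimension `Δ`, with symmetric and positive two-point function: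
* `inversion_scale_master` — the identity obtained from the pair `x = u + 2u'`, `y = 4u + 2u'`
  (`u, u'` unit vectors): `y − x = 3u` while `ι y − ι x = −(3/(2(5+4⟪u,u'⟫))) u'`, so inversion
  covariance compares `S₂` in the directions `u` and `u'`;
* `delta_eq_of_inversion_of_scale'` — taking `u' = u`: `Δ = Δ'` (no rotation invariance needed,
  sharpening `delta_eq_of_inversion_of_scale` of `ScaleRedundant.lean`);
* `two_point_dir_indep`, `two_point_radial_of_inversion` — for `Δ' = Δ` the prefactors cancel
  exactly: `S₂(0,u') = S₂(0,u)` for all unit `u, u'`, i.e. `S₂(0,v) = ‖v‖^{-2Δ} S₂(0,e₀)`: the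
  two-point function is RADIAL, hence `O(3)` invariant (`two_point_isometry_of_inversion`).
So for inversion-first routes the isotropy of the two-point function (and with `EtaExists`-type
arguments the existence of `η`) costs nothing beyond inversion covariance.
-/

noncomputable section

namespace Summit.CriticalPhenomena.Ising3DConformalLimit.MoebiusLimitExistsNegative

open Literature.Probability.LatticeModels EuclideanGeometry RealInnerProductSpace
open scoped RealInnerProductSpace

variable {Δ Δ' : ℝ} {S : CorrFamily 3}

/-! ### Elementary consequences of the covariance predicates at `n = 2` -/

/-- The unit inversion at the origin: `ι z = ‖z‖⁻² z`. [folklore] -/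
theorem inversion_origin_apply (z : EuclideanSpace ℝ (Fin 3)) :
    inversion (0 : EuclideanSpace ℝ (Fin 3)) 1 z = (1 / ‖z‖ ^ 2) • z := by
  rw [inversion, dist_eq_norm, vsub_eq_sub, vadd_eq_add, sub_zero, add_zero, div_pow, one_pow]

/-- Translation to the origin: `S₂(p, q) = S₂(0, q − p)`. [folklore] -/
theorem two_translate (htr : IsTranslationInvariant S) (p q : EuclideanSpace ℝ (Fin 3)) :
    S 2 ![p, q] = S 2 ![0, q - p] := by
  have h := htr 2 (-p) ![p, q]
  have e : (fun i => (![p, q] : Fin 2 → EuclideanSpace ℝ (Fin 3)) i + -p) = ![0, q - p] := by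
    funext i; fin_cases i <;> simp [sub_eq_add_neg]
  rw [e] at h
  exact h.symm

/-- Evenness: `S₂(0, −v) = S₂(0, v)` (translation invariance + symmetry of the pair function).
[folklore] -/
theorem two_even (htr : IsTranslationInvariant S)
    (hsym : ∀ p q : EuclideanSpace ℝ (Fin 3), p ≠ q → S 2 ![p, q] = S 2 ![q, p])
    {v : EuclideanSpace ℝ (Fin 3)} (hv : v ≠ 0) : S 2 ![0, -v] = S 2 ![0, v] := by
  have h := htr 2 v ![0, -v]
  have e : (fun i => (![0, -v] : Fin 2 → EuclideanSpace ℝ (Fin 3)) i + v) = ![v, 0] := by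
    funext i; fin_cases i <;> simp
  rw [e] at h
  rw [← h, hsym v 0 hv, two_translate htr 0 v, sub_zero]

/-- Dilation of the second point: `S₂(0, c v) = c^{-2Δ'} S₂(0, v)`. [folklore] -/
theorem two_scale (hsc : IsScaleCovariant Δ' S) {c : ℝ} (hc : 0 < c) (v : EuclideanSpace ℝ (Fin 3)) :
    S 2 ![0, c • v] = c ^ (-(2:ℝ) * Δ') * S 2 ![0, v] := by
  have h := hsc 2 c hc ![0, v]
  have e : (fun i => c • (![0, v] : Fin 2 → EuclideanSpace ℝ (Fin 3)) i) = ![0, c • v] := by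
    funext i; fin_cases i <;> simp
  rw [e] at h
  rw [h]
  push_cast
  ring_nf

/-- Inversion of a pair avoiding the origin. [folklore] -/
theorem two_inversion (hinv : IsInversionCovariant Δ S) {x y : EuclideanSpace ℝ (Fin 3)} (hx : x ≠ 0)
    (hy : y ≠ 0) :
    S 2 ![inversion 0 1 x, inversion 0 1 y] = ‖x‖ ^ (2 * Δ) * ‖y‖ ^ (2 * Δ) * S 2 ![x, y] := by
  have h := hinv 2 ![x, y] (by intro i; fin_cases i <;> simpa)
  have e : (fun i => inversion (0 : EuclideanSpace ℝ (Fin 3)) 1 ((![x, y] : Fin 2 → EuclideanSpace ℝ (Fin 3)) i)) =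
      ![inversion 0 1 x, inversion 0 1 y] := by
    funext i; fin_cases i <;> rfl
  rw [e, Fin.prod_univ_two] at h
  simpa using h

/-! ### The master identity -/

/-- **The master identity of inversion covariance at `n = 2`.** For unit vectors `u, u'` and
`P = 5 + 4⟪u,u'⟫`, the pair `x = u + 2u'`, `y = 4u + 2u'` has `y − x = 3u` and
`ι y − ι x = −(3/(2P)) u'`; inversion covariance then reads
`(3/(2P))^{-2Δ'} S₂(0,u') = P^Δ (4P)^Δ 3^{-2Δ'} S₂(0,u)`.
[cite: FrancescoMathieuSenechal1997, §4.3.1 eq. (4.55)] -/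
theorem inversion_scale_master (htr : IsTranslationInvariant S) (hsc : IsScaleCovariant Δ' S)
    (hinv : IsInversionCovariant Δ S)
    (hsym : ∀ p q : EuclideanSpace ℝ (Fin 3), p ≠ q → S 2 ![p, q] = S 2 ![q, p])
    {u u' : EuclideanSpace ℝ (Fin 3)} (hu : ‖u‖ = 1) (hu' : ‖u'‖ = 1) :
    (3 / (2 * (5 + 4 * ⟪u, u'⟫))) ^ (-(2:ℝ) * Δ') * S 2 ![0, u'] =
      (5 + 4 * ⟪u, u'⟫) ^ Δ * (4 * (5 + 4 * ⟪u, u'⟫)) ^ Δ * (3:ℝ) ^ (-(2:ℝ) * Δ') * S 2 ![0, u] := by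
  set c : ℝ := ⟪u, u'⟫ with hc
  set P : ℝ := 5 + 4 * c with hP
  have hc1 : -1 ≤ c := by
    have h := abs_real_inner_le_norm u u'
    rw [hu, hu', mul_one] at h
    rw [hc]; linarith [neg_abs_le ⟪u, u'⟫]
  have hPpos : 0 < P := by rw [hP]; linarith
  have huu : ⟪u, u⟫ = 1 := by rw [real_inner_self_eq_norm_sq, hu]; norm_num
  have hu'u' : ⟪u', u'⟫ = 1 := by rw [real_inner_self_eq_norm_sq, hu']; norm_num
  set x : EuclideanSpace ℝ (Fin 3) := u + (2:ℝ) • u' with hx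
  set y : EuclideanSpace ℝ (Fin 3) := (4:ℝ) • u + (2:ℝ) • u' with hy
  -- norms
  have hx2 : ‖x‖ ^ 2 = P := by
    rw [hx, norm_add_sq_real, norm_smul, real_inner_smul_right, hu, hu', Real.norm_eq_abs, ← hc, hP]
    norm_num; ring
  have hy2 : ‖y‖ ^ 2 = 4 * P := by
    rw [hy, norm_add_sq_real, norm_smul, norm_smul, real_inner_smul_left, real_inner_smul_right, hu, hu',
      Real.norm_eq_abs, Real.norm_eq_abs, ← hc, hP]
    norm_num; ring
  have hx0 : x ≠ 0 := by
    intro h0; rw [h0, norm_zero] at hx2; linarith [hx2]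
  have hy0 : y ≠ 0 := by
    intro h0; rw [h0, norm_zero] at hy2; linarith [hy2]
  have hu0 : u' ≠ 0 := by
    intro h0; rw [h0, norm_zero] at hu'; exact zero_ne_one hu'
  -- the two differences
  have hyx : y - x = (3:ℝ) • u := by rw [hy, hx]; module
  have hι : inversion 0 1 y - inversion 0 1 x = (-(3 / (2 * P))) • u' := by
    rw [inversion_origin_apply, inversion_origin_apply, hx2, hy2, hy, hx]
    match_scalars
    · field_simp; ring
    · field_simp; ring
  -- left side of inversion covariance
  have hk : 0 < 3 / (2 * P) := by positivity
  have L : S 2 ![inversion 0 1 x, inversion 0 1 y] = (3 / (2 * P)) ^ (-(2:ℝ) * Δ') * S 2 ![0, u'] := by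
    rw [two_translate htr, hι, neg_smul, two_even htr hsym (smul_ne_zero hk.ne' hu0), two_scale hsc hk]
  -- right side
  have R := two_inversion hinv hx0 hy0
  have R' : S 2 ![x, y] = (3:ℝ) ^ (-(2:ℝ) * Δ') * S 2 ![0, u] := by
    rw [two_translate htr, hyx, two_scale hsc three_pos]
  have hxn : ‖x‖ ^ (2 * Δ) = P ^ Δ := by
    rw [Real.rpow_mul (norm_nonneg _), Real.rpow_two, hx2]
  have hyn : ‖y‖ ^ (2 * Δ) = (4 * P) ^ Δ := by
    rw [Real.rpow_mul (norm_nonneg _), Real.rpow_two, hy2]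
  rw [L, R', hxn, hyn] at R
  rw [R]
  ring

/-- **`Δ = Δ'` from inversion and scale covariance at `n = 2`** (master identity at `u' = u`):
translation invariance, symmetry and positivity of the two-point function suffice — no rotation
invariance. [cite: FrancescoMathieuSenechal1997, §4.3.1 eq. (4.55)] -/
theorem delta_eq_of_inversion_of_scale' (htr : IsTranslationInvariant S) (hsc : IsScaleCovariant Δ' S)
    (hinv : IsInversionCovariant Δ S)
    (hsym : ∀ p q : EuclideanSpace ℝ (Fin 3), p ≠ q → S 2 ![p, q] = S 2 ![q, p])
    (hnd : IsNondegenerateTwoPoint S) : Δ = Δ' := by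
  set u : EuclideanSpace ℝ (Fin 3) := EuclideanSpace.single 0 1 with hu
  have hun : ‖u‖ = 1 := by simp [hu]
  have hpos : 0 < S 2 ![0, u] := hnd _ (zero_unitVec_mem_nonCoincident one_ne_zero)
  have h := inversion_scale_master htr hsc hinv hsym hun hun
  have huu : ⟪u, u⟫ = 1 := by rw [real_inner_self_eq_norm_sq, hun]; norm_num
  rw [huu] at h
  have h' := mul_right_cancel₀ hpos.ne' h
  -- logarithms of both sides
  have eL : Real.log ((3 / (2 * (5 + 4 * (1:ℝ)))) ^ (-(2:ℝ) * Δ')) =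
      (-(2:ℝ) * Δ') * (Real.log 3 - (Real.log 3 + Real.log 6)) := by
    rw [Real.log_rpow (by norm_num), show (3:ℝ) / (2 * (5 + 4 * 1)) = 3 / (3 * 6) by norm_num,
      Real.log_div (by norm_num) (by norm_num), Real.log_mul (by norm_num) (by norm_num)]
  have eR : Real.log ((5 + 4 * (1:ℝ)) ^ Δ * (4 * (5 + 4 * (1:ℝ))) ^ Δ * (3:ℝ) ^ (-(2:ℝ) * Δ')) =
      Δ * (2 * Real.log 3) + Δ * (2 * Real.log 6) + (-(2:ℝ) * Δ') * Real.log 3 := by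
    rw [Real.log_mul (by positivity) (by positivity), Real.log_mul (by positivity) (by positivity),
      Real.log_rpow (by norm_num), Real.log_rpow (by norm_num), Real.log_rpow (by norm_num),
      show (5:ℝ) + 4 * 1 = 3 ^ 2 by norm_num, show (4:ℝ) * 3 ^ 2 = 6 ^ 2 by norm_num,
      Real.log_pow, Real.log_pow]
    push_cast
    ring
  have hl : (-(2:ℝ) * Δ') * (Real.log 3 - (Real.log 3 + Real.log 6)) =
      Δ * (2 * Real.log 3) + Δ * (2 * Real.log 6) + (-(2:ℝ) * Δ') * Real.log 3 := by
    rw [← eL, ← eR, h']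
  have h3 : 0 < Real.log 3 := Real.log_pos (by norm_num)
  have h6 : 0 < Real.log 6 := Real.log_pos (by norm_num)
  have key : (Δ - Δ') * (Real.log 3 + Real.log 6) = 0 := by linear_combination (-1 / 2 : ℝ) * hl
  rcases mul_eq_zero.1 key with h0 | h0
  · linarith
  · linarith

/-- **Direction independence of the two-point function from inversion covariance** (`Δ' = Δ`:
the prefactors of the master identity cancel exactly). [cite: FrancescoMathieuSenechal1997, §4.3.1 eq. (4.55)] -/
theorem two_point_dir_indep (htr : IsTranslationInvariant S) (hsc : IsScaleCovariant Δ S)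
    (hinv : IsInversionCovariant Δ S)
    (hsym : ∀ p q : EuclideanSpace ℝ (Fin 3), p ≠ q → S 2 ![p, q] = S 2 ![q, p])
    {u u' : EuclideanSpace ℝ (Fin 3)} (hu : ‖u‖ = 1) (hu' : ‖u'‖ = 1) :
    S 2 ![0, u'] = S 2 ![0, u] := by
  have h := inversion_scale_master htr hsc hinv hsym hu hu'
  set P : ℝ := 5 + 4 * ⟪u, u'⟫ with hP
  have hc1 : -1 ≤ ⟪u, u'⟫ := by
    have h := abs_real_inner_le_norm u u'
    rw [hu, hu', mul_one] at h
    linarith [neg_abs_le ⟪u, u'⟫]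
  have hPpos : 0 < P := by rw [hP]; linarith
  -- the prefactor identity `(3/(2P))^{-2Δ} = P^Δ (4P)^Δ 3^{-2Δ}`
  have key : (3 / (2 * P)) ^ (-(2:ℝ) * Δ) = P ^ Δ * (4 * P) ^ Δ * (3:ℝ) ^ (-(2:ℝ) * Δ) := by
    have e1 : (3 / (2 * P)) ^ (-(2:ℝ) * Δ) = (3:ℝ) ^ (-(2:ℝ) * Δ) / (2 * P) ^ (-(2:ℝ) * Δ) :=
      Real.div_rpow (by norm_num) (by positivity) _
    have e2 : (2 * P) ^ (-(2:ℝ) * Δ) = ((2 * P) ^ ((2:ℝ) * Δ))⁻¹ := by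
      rw [show (-(2:ℝ) * Δ) = -((2:ℝ) * Δ) by ring, Real.rpow_neg (by positivity)]
    have e3 : (2 * P) ^ ((2:ℝ) * Δ) = P ^ Δ * (4 * P) ^ Δ := by
      rw [Real.rpow_mul (by positivity), Real.rpow_two, ← Real.mul_rpow hPpos.le (by positivity)]
      congr 1; ring
    rw [e1, e2, e3, div_inv_eq_mul]
    ring
  have hKpos : 0 < P ^ Δ * (4 * P) ^ Δ * (3:ℝ) ^ (-(2:ℝ) * Δ) := by positivity
  rw [key] at h
  exact (mul_left_cancel₀ hKpos.ne' h)

/-- **The two-point function is radial**: `S₂(0, v) = ‖v‖^{-2Δ} S₂(0, e₀)` for `v ≠ 0`, from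
translation invariance, scale and inversion covariance with the same `Δ`, symmetry and nothing
else. [cite: FrancescoMathieuSenechal1997, §4.3.1 eq. (4.55)] -/
theorem two_point_radial_of_inversion (htr : IsTranslationInvariant S) (hsc : IsScaleCovariant Δ S)
    (hinv : IsInversionCovariant Δ S)
    (hsym : ∀ p q : EuclideanSpace ℝ (Fin 3), p ≠ q → S 2 ![p, q] = S 2 ![q, p])
    {v : EuclideanSpace ℝ (Fin 3)} (hv : v ≠ 0) :
    S 2 ![0, v] = ‖v‖ ^ (-(2:ℝ) * Δ) * S 2 ![0, EuclideanSpace.single 0 1] := by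
  have hn : 0 < ‖v‖ := norm_pos_iff.2 hv
  set w : EuclideanSpace ℝ (Fin 3) := ‖v‖⁻¹ • v with hw
  have hwn : ‖w‖ = 1 := by
    rw [hw, norm_smul, norm_inv, norm_norm, inv_mul_cancel₀ hn.ne']
  have hen : ‖(EuclideanSpace.single 0 1 : EuclideanSpace ℝ (Fin 3))‖ = 1 := by simp
  have hvw : v = ‖v‖ • w := by rw [hw, smul_smul, mul_inv_cancel₀ hn.ne', one_smul]
  rw [hvw, two_scale hsc hn, two_point_dir_indep htr hsc hinv hsym hen hwn, norm_smul, norm_norm, hwn,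
    mul_one]

/-- **`O(3)` invariance of the two-point function from inversion covariance**: for every linear
isometry `R` and `p ≠ q`, `S₂(Rp, Rq) = S₂(p, q)`. [cite: FrancescoMathieuSenechal1997, §4.3.1 eq. (4.55)] -/
theorem two_point_isometry_of_inversion (htr : IsTranslationInvariant S) (hsc : IsScaleCovariant Δ S)
    (hinv : IsInversionCovariant Δ S)
    (hsym : ∀ p q : EuclideanSpace ℝ (Fin 3), p ≠ q → S 2 ![p, q] = S 2 ![q, p])
    (R : EuclideanSpace ℝ (Fin 3) ≃ₗᵢ[ℝ] EuclideanSpace ℝ (Fin 3)) {p q : EuclideanSpace ℝ (Fin 3)}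
    (hpq : p ≠ q) : S 2 ![R p, R q] = S 2 ![p, q] := by
  have h1 : q - p ≠ 0 := sub_ne_zero.2 hpq.symm
  have h2 : R q - R p ≠ 0 := sub_ne_zero.2 fun h => hpq.symm (R.injective h)
  rw [two_translate htr (R p) (R q), two_translate htr p q,
    two_point_radial_of_inversion htr hsc hinv hsym h2, two_point_radial_of_inversion htr hsc hinv hsym h1,
    ← map_sub, LinearIsometryEquiv.norm_map]

end Summit.CriticalPhenomena.Ising3DConformalLimit.MoebiusLimitExistsNegative

end
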